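import Summits.FinalStateConjecture.FinalStateConjecture.Theses.ExactKerrEnds
import Literature.Geometry.Lorentzian.KIDPatchImmersion
import Literature.Geometry.Lorentzian.SpacetimePositiveMassRigidityProofs

/-!
# Line `kids-holonomy-graph` for crux `ZeroMassAdmissibleMinkowskian` (stmt-FinalStateConjecture-18053)
# of route `ExactKerrEnds` — crux-strategist skeleton (4 registered stubs + kernel-checked composition)

The crux AS TYPED: an admissible vacuum datum `d` on `X`, DR-flat with mass parameter `0` on a sole end
`e`, has a Cauchy development WHICH IS Minkowski space-time
(`∃ 𝒟 : CauchyDevelopment d, 𝒟.toSpacetime = Minkowski.spacetime`). Beig–Chruściel 1996, Thm. 4.1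
(`m = 0`), vacuum/DR special case; no carrier in the tree (XL).

The cut follows the printed proof's architecture (analytic half / geometric half, already recorded at
fact level by `positive_mass_rigidity_spacetime_of_kids`) but GLOBALISES the geometric half through the
tree's developing-map / covering-space library instead of the Killing development + Wolf's theorem, and
isolates the one topological theorem ("zero-mass KID data live on simply connected manifolds"):

* `stub_kidsOfZeroMass` — ANALYTIC CORE (XL; Witten's equation with `m = 0`, Beig–Chruściel App. A
  (A.8)–(A.11.0); or, when `H₂(X;ℤ) = 0`, Hirsch–Kazaras–Khuri 2022 Thm. 7.3: spacetime-Hessian-free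
  functions `∇²u = −k|∇u|` give the null KIDs `(|∇u|, ∇u)`): the crux hypotheses give four translational
  KIDs `(N_a, Y_a)` — `h(∇ᵥY_a, w) = −N_a k(v,w)`, `dN_a(v) = −k(v, Y_a)` — with Minkowskian Gram matrix
  and `N₀ > 0`, as GLOBAL sections on `X` (no primitives asked: that is where topology enters).
* `stub_simplyConnectedOfKids` — TOPOLOGY (L–XL): a complete (admissible) datum carrying such KIDs lives
  on a simply connected `X`. Plan: the local Minkowski immersions `exists_local_minkowski_immersion_of_kids`
  (KIDPatchImmersion) form a `GStructure.Atlas` into `ℝ⁴` with translation transitions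
  (`exists_eventuallyEq_add_const_of_mfderiv_eq`); its germ space `X̂ → X` is a covering
  (`GStructure.Atlas.isCoveringMap_pt`) carrying the developing map `ev : X̂ → ℝ⁴`; on a component `X̂₀`
  (a manifold, `CoveringSpaceManifold`; pulled-back metric complete, `isGeodesicallyComplete_comap_of_isCoveringMap`)
  the spatial projection `π ∘ ev : (X̂₀, ĥ + (d ev⁰)²) → (ℝ³, δ)` is a LOCAL ISOMETRY from a complete
  manifold (ĝ ≥ ĥ, Hopf–Rinow), hence a covering (`CartanHadamard.surjective_and_isCoveringMap_of_isGeodesicallyComplete`,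
  Lee 6.23), hence a homeomorphism (`exists_homeomorph_of_isCoveringMap_of_simplyConnectedSpace`); so
  `X̂₀ ≅ ℝ³` covers `X`, and a covering of a space with an AF end by `ℝ³` is a homeomorphism
  (`AFEnd.isHomeomorph_of_isCoveringMap`). (Alternative: Beig–Chruściel §4, Killing development +
  `FlatCovering`.) Honest content: the one-end structure kills the translation periods.
* `stub_globalImmersionOfKids` — GLUING (M): on a simply connected `X` the local immersions glue to a global
  smooth spacelike immersion `F : X → (ℝ⁴, η)` with future unit normal `ν`, `F^*η = h`, `K_ν = k`
  (`exists_glue_of_locally_eq_add_const`, TranslationDevelopment; Beig–Chruściel §4 "isometric embedding").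
* `stub_minkowskiDevelopmentOfImmersion` — CAUCHY GRAPH (L): for a complete DR-flat datum such an `F` is an
  embedding onto an ENTIRE graph `{t = u(x)}` with `‖du‖ ≤ θ < 1` (`π ∘ F` is a local isometry for
  `h + (dF⁰)²`, complete ⇒ covering ⇒ bijection onto `ℝ³`; `θ = sup |Y₀|/N₀ < 1` from the lapse equation
  `dN₀ = −k(·, Y₀)` and `k = o₁(r⁻²)`), hence a Cauchy hypersurface
  (`Minkowski.isCauchyHypersurface_range_graph_of_fderiv`) and `CauchyDevelopment d` with
  `toSpacetime = Minkowski.spacetime` (pattern `Minkowski.exists_cauchyDevelopment_eq_spacetime_graph`).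

`ZeroMassAdmissibleMinkowskian_of` composes them (sorry-free): KIDs (stub 1) ⇒ simply connected (stub 2) ⇒
global immersion (stub 3) ⇒ Minkowski Cauchy development (stub 4). Sorries live only in the four stubs.
Disproof used: none exists for this crux (`ledger crux ls stmt-FinalStateConjecture-18053`: no workfiles,
2026-08-17; no `Theorems/ZeroMassAdmissibleMinkowskian/Negative/` lemmas); the refuter's birth attack
(item notes) records that the conclusion forces `X ≃ₜ ℝ³` — stub 2 is exactly that obstruction, typed.
-/

namespace Summit.FinalStateConjecture.FinalStateConjecture.Cruxes.ZeroMassAdmissibleMinkowskian.KidsHolonomyGraph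

open scoped Manifold ContDiff Topology
open Bundle Set Function Literature.Geometry.Lorentzian

/-! ## Statements of the four stubs as named propositions -/

/-- Statement of `stub_kidsOfZeroMass` (ANALYTIC CORE: zero mass ⇒ four translational KIDs with
Minkowskian Gram matrix and positive lapse, global sections on `X`). -/
def KidsOfZeroMass : Prop := ∀ (X : Type) [TopologicalSpace X] [ChartedSpace E3 X] [IsManifold (𝓡 3) ∞ X] [T2Space X] [SecondCountableTopology X] [ConnectedSpace X], ∀ (d : InitialDataSet (𝓡 3) X) [d.metric.HasLeviCivita], d ∈ admissibleVacuumData X → ∀ (e : AFEnd X), e.IsSoleEnd → e.IsStronglyAsymptoticallyFlatDR d 0 → ∃ (N : Fin 4 → X → ℝ) (Y : Fin 4 → Π x : X, TangentSpace (𝓡 3) x), (∀ a, ContMDiff (𝓡 3) 𝓘(ℝ, ℝ) ∞ (N a)) ∧ (∀ a, ContMDiff (𝓡 3) ((𝓡 3).prod (𝓡 3)) ∞ fun x ↦ (TotalSpace.mk' E3 x (Y a x) : TangentBundle (𝓡 3) X)) ∧ (∀ a (x : X) (v w : TangentSpace (𝓡 3) x), d.metric.val x (d.metric.leviCivita (Y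 a) x v) w = -(N a x * d.k x v w)) ∧ (∀ a (x : X) (v : TangentSpace (𝓡 3) x), mvfderiv (𝓡 3) (N a) x v = -(d.k x v (Y a x))) ∧ (∀ (x : X) a b, -(N a x * N b x) + d.h.inner x (Y a x) (Y b x) = if a = b then (if a = 0 then -1 else 1) else 0) ∧ ∀ x, 0 < N 0 x

/-- Statement of `stub_simplyConnectedOfKids` (TOPOLOGY: complete data carrying translational KIDs with
Minkowskian Gram matrix live on a simply connected manifold). -/
def SimplyConnectedOfKids : Prop := ∀ (X : Type) [TopologicalSpace X] [ChartedSpace E3 X] [IsManifold (𝓡 3) ∞ X] [T2Space X] [SecondCountableTopology X] [ConnectedSpace X], ∀ (d : InitialDataSet (𝓡 3) X) [d.metric.HasLeviCivita], d ∈ admissibleVacuumData X → (∃ (N : Fin 4 → X → ℝ) (Y : Fin 4 → Π x : X, TangentSpace (𝓡 3) x), (∀ a, ContMDiff (𝓡 3) 𝓘(ℝ, ℝ) ∞ (N a)) ∧ (∀ a, ContMDiff (𝓡 3) ((𝓡 3).prod (𝓡 3)) ∞ fun x ↦ (TotalSpace.mk' E3 x (Y a x) : TangentBundle (𝓡 3)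 X)) ∧ (∀ a (x : X) (v w : TangentSpace (𝓡 3) x), d.metric.val x (d.metric.leviCivita (Y a) x v) w = -(N a x * d.k x v w)) ∧ (∀ a (x : X) (v : TangentSpace (𝓡 3) x), mvfderiv (𝓡 3) (N a) x v = -(d.k x v (Y a x))) ∧ (∀ (x : X) a b, -(N a x * N b x) + d.h.inner x (Y a x) (Y b x) = if a = b then (if a = 0 then -1 else 1) else 0) ∧ ∀ x, 0 < N 0 x) → SimplyConnectedSpace X

/-- Statement of `stub_globalImmersionOfKids` (GLUING: on a simply connected manifold the KIDs integrate to
a global spacelike immersion into Minkowski space-time inducing `(h, k)`). -/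
def GlobalImmersionOfKids : Prop := ∀ (X : Type) [TopologicalSpace X] [ChartedSpace E3 X] [IsManifold (𝓡 3) ∞ X] [T2Space X] [SecondCountableTopology X] [ConnectedSpace X] [SimplyConnectedSpace X], ∀ (d : InitialDataSet (𝓡 3) X) [d.metric.HasLeviCivita], (∃ (N : Fin 4 → X → ℝ) (Y : Fin 4 → Π x : X, TangentSpace (𝓡 3) x), (∀ a, ContMDiff (𝓡 3) 𝓘(ℝ, ℝ) ∞ (N a)) ∧ (∀ a, ContMDiff (𝓡 3) ((𝓡 3).prod (𝓡 3)) ∞ fun x ↦ (TotalSpace.mk' E3 x (Y a x) : TangentBundle (𝓡 3) X)) ∧ (∀ a (x : X) (v w : TangentSpace (𝓡 3) x), d.metric.val x (d.metric.leviCivita (Y a) x v) w = -(N a x * d.k x v w)) ∧ (∀ a (x : X) (v : TangentSpace (𝓡 3) x), mvfderiv (𝓡 3) (N a) x v = -(d.k x v (Y a x))) ∧ (∀ (x : X) a b, -(N a x * N b x) + d.h.inner x (Y a x) (Y b x) = if a = b then (if a = 0 then -1 else 1) else 0) ∧ ∀ x, 0 < N 0 x) → ∃ (F : X → E4) (ν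 : X → E4), Minkowski.smoothMetric.toPseudoRiemannianMetric.IsSpacelikeImmersion (𝓡 3) F ∧ Minkowski.smoothMetric.IsFutureUnitNormal (𝓡 3) (Minkowski.timeOrientation.ofLE le_top) F ν ∧ ContMDiff (𝓡 3) 𝓘(ℝ, E4).tangent ∞ (fun y ↦ (TotalSpace.mk' E4 (F y) (ν y) : TangentBundle 𝓘(ℝ, E4) E4)) ∧ (∀ (y : X) (v w : TangentSpace (𝓡 3) y), Minkowski.smoothMetric.toPseudoRiemannianMetric.inducedBilin (𝓡 3) F y v w = d.h.inner y v w) ∧ ∀ [Minkowski.smoothMetric.toPseudoRiemannianMetric.HasLeviCivita] (y : X) (v w : TangentSpace (𝓡 3) y), Minkowski.smoothMetric.toPseudoRiemannianMetric.secondFundamentalForm (𝓡 3) F ν y v w = d.k y v w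

/-- Statement of `stub_minkowskiDevelopmentOfImmersion` (CAUCHY GRAPH: a global spacelike immersion of a
complete, DR-flat datum into Minkowski space-time inducing `(h, k)` is an embedding onto a Cauchy
hypersurface, i.e. Minkowski space-time is a Cauchy development of the datum). -/
def MinkowskiDevelopmentOfImmersion : Prop := ∀ (X : Type) [TopologicalSpace X] [ChartedSpace E3 X] [IsManifold (𝓡 3) ∞ X] [T2Space X] [SecondCountableTopology X] [ConnectedSpace X], ∀ (d : InitialDataSet (𝓡 3) X) [d.metric.HasLeviCivita], d ∈ admissibleVacuumData X → ∀ (e : AFEnd X), e.IsSoleEnd → e.IsStronglyAsymptoticallyFlatDR d 0 → ∀ (F : X → E4) (ν : X → E4), (Minkowski.smoothMetric.toPseudoRiemannianMetric.IsSpacelikeImmersion (𝓡 3) F ∧ Minkowski.smoothMetric.IsFutureUnitNormal (𝓡 3) (Minkowski.timeOrientation.ofLE le_top) F ν ∧ ContMDiff (𝓡 3) 𝓘(ℝ, E4).tangent ∞ (fun y ↦ (TotalSpace.mk' E4 (F y) (ν y) : TangentBundle 𝓘(ℝ, E4) E4)) ∧ (∀ (y : X) (v w : TangentSpace (𝓡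 3) y), Minkowski.smoothMetric.toPseudoRiemannianMetric.inducedBilin (𝓡 3) F y v w = d.h.inner y v w) ∧ ∀ [Minkowski.smoothMetric.toPseudoRiemannianMetric.HasLeviCivita] (y : X) (v w : TangentSpace (𝓡 3) y), Minkowski.smoothMetric.toPseudoRiemannianMetric.secondFundamentalForm (𝓡 3) F ν y v w = d.k y v w) → ∃ 𝒟 : CauchyDevelopment d, 𝒟.toSpacetime = Minkowski.spacetime

namespace Goal
/-- Statement of `stub_kidsOfZeroMass`, under the stub's name. -/
abbrev stub_kidsOfZeroMass : Prop := KidsOfZeroMass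
/-- Statement of `stub_simplyConnectedOfKids`, under the stub's name. -/
abbrev stub_simplyConnectedOfKids : Prop := SimplyConnectedOfKids
/-- Statement of `stub_globalImmersionOfKids`, under the stub's name. -/
abbrev stub_globalImmersionOfKids : Prop := GlobalImmersionOfKids
/-- Statement of `stub_minkowskiDevelopmentOfImmersion`, under the stub's name. -/
abbrev stub_minkowskiDevelopmentOfImmersion : Prop := MinkowskiDevelopmentOfImmersion
end Goal

/-! ## Registered stubs (the only `sorry`s of the file), stated expanded -/

/-- stub 1 — ANALYTIC CORE (the crux's research-level formalisation debt; Witten 1981 / Parker–Taubes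
1982 / Beig–Chruściel 1996 App. A: for `m = 0` the Sen–Witten spinors asymptotic to every constant
spinor are Sen-parallel and their bilinears `(N, Yⁱ)` solve the parallel KID system (A.11)–(A.11.0);
the four translations have Gram matrix `η` by the conservation law `KillingInitialDataPairing` and
their asymptotic values; alternatively Hirsch–Kazaras–Khuri 2022 §7 when `H₂(X;ℤ) = 0`). For an
admissible vacuum datum, DR-flat of mass `0` on a sole end: four smooth pairs `(N_a, Y_a)` on `X` with
`h(∇ᵥY_a, w) = −N_a k(v, w)`, `dN_a(v) = −k(v, Y_a)`, `−N_aN_b + h(Y_a, Y_b) = η_ab`, `N₀ > 0`. -/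
theorem stub_kidsOfZeroMass : ∀ (X : Type) [TopologicalSpace X] [ChartedSpace E3 X] [IsManifold (𝓡 3) ∞ X] [T2Space X] [SecondCountableTopology X] [ConnectedSpace X], ∀ (d : InitialDataSet (𝓡 3) X) [d.metric.HasLeviCivita], d ∈ admissibleVacuumData X → ∀ (e : AFEnd X), e.IsSoleEnd → e.IsStronglyAsymptoticallyFlatDR d 0 → ∃ (N : Fin 4 → X → ℝ) (Y : Fin 4 → Π x : X, TangentSpace (𝓡 3) x), (∀ a, ContMDiff (𝓡 3) 𝓘(ℝ, ℝ) ∞ (N a)) ∧ (∀ a, ContMDiff (𝓡 3) ((𝓡 3).prod (𝓡 3)) ∞ fun x ↦ (TotalSpace.mk' E3 x (Y a x) : TangentBundle (𝓡 3) X)) ∧ (∀ a (x : X) (v w : TangentSpace (𝓡 3) x), d.metric.val x (d.metric.leviCivita (Y a) x v) w = -(N a x * d.k x v w)) ∧ (∀ a (x : X) (v : TangentSpace (𝓡 3) x), mvfderiv (𝓡 3) (N a) x v = -(d.k x v (Y a x))) ∧ (∀ (x : X) a b, -(N a x * N b x) + d.h.inner x (Y a x) (Y b x) = if a = b then (if a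 = 0 then -1 else 1) else 0) ∧ ∀ x, 0 < N 0 x := by
  sorry

/-- stub 2 — TOPOLOGY (Beig–Chruściel 1996, §4, p. 13: "if `Σ` had been non-simply connected, then `Σ̃`
would have had more than one asymptotic end"; here via the holonomy covering of the atlas of local
Minkowski immersions `exists_local_minkowski_immersion_of_kids`, `GStructure.Atlas.isCoveringMap_pt`, the
local-isometry covering criterion `CartanHadamard.surjective_and_isCoveringMap_of_isGeodesicallyComplete`
for the complete metric `ĥ + (d ev⁰)²` over `(ℝ³, δ)`, and `AFEnd.isHomeomorph_of_isCoveringMap`). A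
complete (admissible) datum carrying four translational KIDs with Minkowskian Gram matrix and `N₀ > 0`
lives on a simply connected `X`. -/
theorem stub_simplyConnectedOfKids : ∀ (X : Type) [TopologicalSpace X] [ChartedSpace E3 X] [IsManifold (𝓡 3) ∞ X] [T2Space X] [SecondCountableTopology X] [ConnectedSpace X], ∀ (d : InitialDataSet (𝓡 3) X) [d.metric.HasLeviCivita], d ∈ admissibleVacuumData X → (∃ (N : Fin 4 → X → ℝ) (Y : Fin 4 → Π x : X, TangentSpace (𝓡 3) x), (∀ a, ContMDiff (𝓡 3) 𝓘(ℝ, ℝ) ∞ (N a)) ∧ (∀ a, ContMDiff (𝓡 3) ((𝓡 3).prod (𝓡 3)) ∞ fun x ↦ (TotalSpace.mk' E3 x (Y a x) : TangentBundle (𝓡 3) X)) ∧ (∀ a (x : X) (v w : TangentSpace (𝓡 3) x), d.metric.val x (d.metric.leviCivita (Y a) x v) w = -(N a x * d.k x v w)) ∧ (∀ a (x : X) (v : TangentSpace (𝓡 3) x), mvfderiv (𝓡 3) (N a) x v = -(d.k x v (Y a x))) ∧ (∀ (x : X) a b, -(N a x * N b x) + d.h.inner x (Y a x) (Y b x) =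 if a = b then (if a = 0 then -1 else 1) else 0) ∧ ∀ x, 0 < N 0 x) → SimplyConnectedSpace X := by
  sorry

/-- stub 3 — GLUING (Beig–Chruściel 1996, §4 "isometric embedding `i` of `Σ` into Minkowski space-time";
local pieces `exists_local_minkowski_immersion_of_kids` have differentials `(ε_a h(Y_a, ·))_a`, so any two
differ by a constant on overlaps (`exists_eventuallyEq_add_const_of_mfderiv_eq`) and glue on a simply
connected `X` (`exists_glue_of_locally_eq_add_const`); induced metric and shape tensor are local). On a
simply connected `X`, KIDs as in stub 1 integrate to a global smooth spacelike immersion `F : X → (ℝ⁴, η)`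
with smooth future unit normal `ν`, `F^*η = h` and `K_ν = k`. -/
theorem stub_globalImmersionOfKids : ∀ (X : Type) [TopologicalSpace X] [ChartedSpace E3 X] [IsManifold (𝓡 3) ∞ X] [T2Space X] [SecondCountableTopology X] [ConnectedSpace X] [SimplyConnectedSpace X], ∀ (d : InitialDataSet (𝓡 3) X) [d.metric.HasLeviCivita], (∃ (N : Fin 4 → X → ℝ) (Y : Fin 4 → Π x : X, TangentSpace (𝓡 3) x), (∀ a, ContMDiff (𝓡 3) 𝓘(ℝ, ℝ) ∞ (N a)) ∧ (∀ a, ContMDiff (𝓡 3) ((𝓡 3).prod (𝓡 3)) ∞ fun x ↦ (TotalSpace.mk' E3 x (Y a x) : TangentBundle (𝓡 3) X)) ∧ (∀ a (x : X) (v w : TangentSpace (𝓡 3) x), d.metric.val x (d.metric.leviCivita (Y a) x v) w = -(N a x * d.k x v w)) ∧ (∀ a (x : X) (v : TangentSpace (𝓡 3) x), mvfderiv (𝓡 3) (N a) x v = -(d.k x v (Y a x))) ∧ (∀ (x : X) a b, -(N a x * N b x) + d.h.inner x (Y a x) (Y b x) = if a = b then (if a = 0 then -1 else 1) else 0) ∧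 ∀ x, 0 < N 0 x) → ∃ (F : X → E4) (ν : X → E4), Minkowski.smoothMetric.toPseudoRiemannianMetric.IsSpacelikeImmersion (𝓡 3) F ∧ Minkowski.smoothMetric.IsFutureUnitNormal (𝓡 3) (Minkowski.timeOrientation.ofLE le_top) F ν ∧ ContMDiff (𝓡 3) 𝓘(ℝ, E4).tangent ∞ (fun y ↦ (TotalSpace.mk' E4 (F y) (ν y) : TangentBundle 𝓘(ℝ, E4) E4)) ∧ (∀ (y : X) (v w : TangentSpace (𝓡 3) y), Minkowski.smoothMetric.toPseudoRiemannianMetric.inducedBilin (𝓡 3) F y v w = d.h.inner y v w) ∧ ∀ [Minkowski.smoothMetric.toPseudoRiemannianMetric.HasLeviCivita] (y : X) (v w : TangentSpace (𝓡 3) y), Minkowski.smoothMetric.toPseudoRiemannianMetric.secondFundamentalForm (𝓡 3) F ν y v w = d.k y v w := by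
  sorry

/-- stub 4 — CAUCHY GRAPH (Beig–Chruściel 1996, §4, p. 13: "`Σ̃` is necessarily a graph over a spacelike
plane … an asymptotically flat Cauchy surface in `(ℝ⁴, η)`"; Hirsch–Kazaras–Khuri 2022, Thm. 7.3, last
paragraph). For a complete datum, DR-flat of mass `0` on a sole end, a global spacelike immersion
`F : X → (ℝ⁴, η)` with smooth future unit normal inducing `(h, k)` is an embedding onto an entire graph with
Lipschitz constant `θ < 1` (`π ∘ F` is a local isometry `(X, h + (dF⁰)²) → (ℝ³, δ)` from a complete manifold,
hence a covering, hence a bijection; `θ = sup ‖Y₀‖/N₀ < 1` by the lapse equation `dN₀ = −k(·, Y₀)`,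
`‖Y₀‖² = N₀² − 1` and `k = o₁(r⁻²)`), so its image is a Cauchy hypersurface
(`Minkowski.isCauchyHypersurface_range_graph_of_fderiv`) and Minkowski space-time is a Cauchy development
of `d` (pattern `Minkowski.exists_cauchyDevelopment_eq_spacetime_graph`). -/
theorem stub_minkowskiDevelopmentOfImmersion : ∀ (X : Type) [TopologicalSpace X] [ChartedSpace E3 X] [IsManifold (𝓡 3) ∞ X] [T2Space X] [SecondCountableTopology X] [ConnectedSpace X], ∀ (d : InitialDataSet (𝓡 3) X) [d.metric.HasLeviCivita], d ∈ admissibleVacuumData X → ∀ (e : AFEnd X), e.IsSoleEnd → e.IsStronglyAsymptoticallyFlatDR d 0 → ∀ (F : X → E4) (ν : X → E4), (Minkowski.smoothMetric.toPseudoRiemannianMetric.IsSpacelikeImmersion (𝓡 3) F ∧ Minkowski.smoothMetric.IsFutureUnitNormal (𝓡 3) (Minkowski.timeOrientation.ofLE le_top) F ν ∧ ContMDiff (𝓡 3) 𝓘(ℝ, E4).tangent ∞ (fun y ↦ (TotalSpace.mk' E4 (F y) (ν y) : TangentBundle 𝓘(ℝ, E4) E4)) ∧ (∀ (y : X) (v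 w : TangentSpace (𝓡 3) y), Minkowski.smoothMetric.toPseudoRiemannianMetric.inducedBilin (𝓡 3) F y v w = d.h.inner y v w) ∧ ∀ [Minkowski.smoothMetric.toPseudoRiemannianMetric.HasLeviCivita] (y : X) (v w : TangentSpace (𝓡 3) y), Minkowski.smoothMetric.toPseudoRiemannianMetric.secondFundamentalForm (𝓡 3) F ν y v w = d.k y v w) → ∃ 𝒟 : CauchyDevelopment d, 𝒟.toSpacetime = Minkowski.spacetime := by
  sorry

/-! Consistency (elaborated, not kept in the environment): each expanded stub statement is, by
`δ`-unfolding, the named proposition the composition consumes. -/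
example : Goal.stub_kidsOfZeroMass := stub_kidsOfZeroMass
example : Goal.stub_simplyConnectedOfKids := stub_simplyConnectedOfKids
example : Goal.stub_globalImmersionOfKids := stub_globalImmersionOfKids
example : Goal.stub_minkowskiDevelopmentOfImmersion := stub_minkowskiDevelopmentOfImmersion

/-! ## The composition (kernel-checked; no `sorry` of its own) -/

/-- THE CRUX BY NAME from the four registered stubs: fix `X`, the admissible datum `d` (its Levi-Civita
instance `d.metric.hasLeviCivita`), the sole DR-flat end `e`; stub 1 gives the KIDs, stub 2 makes `X`
simply connected, stub 3 integrates the KIDs to a global Minkowski immersion `(F, ν)` inducing `(h, k)`,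
and stub 4 turns it into a Cauchy development which is `Minkowski.spacetime`. -/
theorem ZeroMassAdmissibleMinkowskian_of :
    Goal.stub_kidsOfZeroMass → Goal.stub_simplyConnectedOfKids → Goal.stub_globalImmersionOfKids →
      Goal.stub_minkowskiDevelopmentOfImmersion →
      Summit.FinalStateConjecture.FinalStateConjecture.Theses.ExactKerrEnds.ZeroMassAdmissibleMinkowskian := by
  intro h₁ h₂ h₃ h₄ X _ _ _ _ _ _ d hd e hsole hDR
  haveI := d.metric.hasLeviCivita
  have hK := h₁ X d hd e hsole hDR
  haveI : SimplyConnectedSpace X := h₂ X d hd hK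
  obtain ⟨F, ν, hF⟩ := h₃ X d hK
  exact h₄ X d hd e hsole hDR F ν hF

end Summit.FinalStateConjecture.FinalStateConjecture.Cruxes.ZeroMassAdmissibleMinkowskian.KidsHolonomyGraph
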